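import Summits.BirchSwinnertonDyer.Rank1Residual.X11b.LocalKernelCoinvariantsExact
import Summits.BirchSwinnertonDyer.Rank1Residual.X11b.BDPRouteNonsingularTorsionDivisible
import Summits.BirchSwinnertonDyer.Rank1Residual.X11b.AnticyclotomicGoodPlaces
import Summits.BirchSwinnertonDyer.Rank1Residual.X11b.LocalTrivialityBridge
import Literature.NumberTheory.EllipticCurves.ZpExtensionUnramifiedProofs
import HarnessLib

/-!
# X11b, route R1 — the `p`-primary non-singular part `B₀ ≤ B_v = E[p^∞]^{ker κ ⊓ D_v}` and the
# `D_v`-fixed `p`-power torsion `B_v^{γ_v} = E(K_v)[p^∞]` (atom (P11), Step 2a: the objects)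

HONEST FRAMING (cell `b2b-bsdres`, run/shared/lean/b2b/bsd-rank1-residual/, verbatim in every
file): the goal of the cell is to DELETE the COMBINATION-SHAPED residual classes of the
Birch–Swinnerton-Dyer formula for ALL analytic-rank `≤ 1` elliptic curves over `ℚ` — "full BSD
formula for every rank `≤ 1` curve in class `C`" assembled STRICTLY from published theorems — so
that the rank-`≤ 1` remainder becomes exactly the CONSTRUCTION-SHAPED classes, which are TYPED
(missing-input `Prop`s), NOT attempted. This is not "finishing BSD". Sub-cell
`b2b-bsdres-multr1-p1` (X11b, route R1 = Castella 2018 Thm. A re-proved along the author's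
erratum); a RESEARCH ROUTE; no claim beyond the stated class; X11b stays CONSTRUCTION-SHAPED;
nothing here changes a label; no named fact is minted (two plumbing definitions with bodies —
`toInertiaFixed`, `nonsingularPrimary` — and theorems; no `sorry`).

## What this file proves

Greenberg (LNM 1716, §3 Lemma 3.3 at a bad `v ∤ p`; §4 p. 74): `ker r_v ≅ B_v/(γ_v − 1)B_v` has
order `c_v^{(p)}` because the `μ`/torus part `E₀(K_{∞,η})[p^∞]` of `B_v = E(K_{∞,η})[p^∞]` is
divisible by `γ_v − 1` while the component part `E(K_v)[p^∞]/E₀(K_v)[p^∞] ≅ Φ_v(k_v)[p^∞]` is not.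
The LOWER bound `#ker r_v ≥ [B_v^{γ_v} : B_v^{γ_v} ⊓ B₀]` for any `(γ_v − 1)`-stable finite-index
`B₀ ≤ B_v` is `LocalKernelCoinvariantsLower` (gen 18). This file supplies the `B₀` and the kernel:

* `toInertiaFixed` — the inclusion `B_v = E[p^∞]^{ker κ ⊓ D_v} → E(K̄)^{I_v}` (`I_v ≤ ker κ`: a
  `ℤ_p`-extension is unramified at `v ∤ p`, Washington 13.2, tree `inertia_le_kerSubgroup_holds`;
  `I_v ≤ D_v`);
* `nonsingularPrimary` — **`B₀ :=`** the preimage of route p2's `nonsingularPart` (the points of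
  `E(K̄)^{I_v} = E(K_v^{nr})^{alg}` with non-singular reduction on the minimal model, Silverman's `E₀`)
  — i.e. `E₀(K_{∞,η})[p^∞]^{alg}`;
* `decompSubOne_mem_nonsingularPrimary` — `B₀` is `(g − 1)`-stable for `g ∈ D_v` (p2's (g1));
* `finite_quotient_nonsingularPrimary` — `B_v/B₀` is finite (`↪ E(K̄)^{I_v}/E₀`, Kodaira–Néron over
  `K_v^{nr}`, p2's (g2));
* `decompSubOne_primary_eq_zero_iff` — **`ker(g − 1) = E[p^∞]^{D_v}`** on `B_v` for `g` generating
  `D_v` topologically modulo `D_v ⊓ ker κ` (open stabilisers; p2's `decompSubOne_eq_zero_iff` for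
  `E[p^∞]` in place of `E(K̄)`): Greenberg's "the kernel of `γ_v − 1` on `B_v` is `E(F_v)_p`".

Next file: `[B_v^{γ_v} : B_v^{γ_v} ⊓ B₀] = #Φ_v(k_v)[p^∞] = c_v^{(p)}` (Galois descent to `X(K_v)`,
Silverman VII.6.3) and the assembly `#ker r_v = c_v^{(p)}`.

References: [GreenbergLNM1716] §3 Lemma 3.3 (p. 87), §4 proof of Thm. 4.1 (pp. 74–75);
[SilvermanAEC2009] VII.§2 (`E₀`), Thm. VII.6.1 / Cor. VII.6.2; [Washington1997] Prop. 13.2.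
-/

noncomputable section

open scoped Classical NNReal

open NumberField IsDedekindDomain Field Function WeierstrassCurve
open Literature.NumberTheory.EllipticCurves Literature.NumberTheory.EllipticCurves.GreenbergSelmer
open Literature.NumberTheory.GaloisRepresentations

namespace Summit.BirchSwinnertonDyer.Rank1Residual.X11b.AcSelmer

-- `K : Type` as in the route-R1 files (`AnticyclotomicGoodPlaces`), where `I_v ≤ D_v` lives.
variable {K : Type} [Field K] [NumberField K] (W : WeierstrassCurve K) {p : ℕ} [Fact p.Prime]
  (κ : ZpExtension K p) {v : HeightOneSpectrum (𝓞 K)}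

/-! ## 1. `ker(γ_v − 1) = E[p^∞]^{D_v}` on `B_v = E[p^∞]^{ker κ ⊓ D_v}` -/

section Kernel

/-- **`ker (g − 1) = E[p^∞]^{D_v}` on `B_v = E[p^∞]^{ker κ ⊓ D_v}`**: a `p`-power torsion point
fixed by `ker κ ⊓ D_v` and by a `g ∈ D_v` generating `D_v` topologically modulo `D_v ⊓ ker κ` is
fixed by all of `D_v` (its stabiliser is open, `isOpen_stabilizer_geomPrimaryTorsion`). Greenberg:
"the kernel of `γ_v − 1` acting on `B_v` … is `E(F_v)_p`" (p. 87). Route p2's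
`decompSubOne_eq_zero_iff` is the same statement for `E(K̄)` in place of `E[p^∞]`.
[cite: GreenbergLNM1716, §3 Lemma 3.3 (proof, p. 87)] -/
theorem decompSubOne_primary_eq_zero_iff
    {g : ↥((⊤ : Subgroup (absoluteGaloisGroup K)) ⊓ decomp v)}
    (hgen : ∀ U : Subgroup ↥((⊤ : Subgroup (absoluteGaloisGroup K)) ⊓ decomp v),
      IsOpen (U : Set ↥((⊤ : Subgroup (absoluteGaloisGroup K)) ⊓ decomp v)) →
        κ.kerSubgroup.subgroupOf ((⊤ : Subgroup (absoluteGaloisGroup K)) ⊓ decomp v) ≤ U →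
          g ∈ U → U = ⊤)
    (b : FixedPoints.addSubgroup ↥(κ.kerSubgroup ⊓ decomp v) (W.geomPrimaryTorsion p)) :
    decompSubOne κ (W.geomPrimaryTorsion p) (g : absoluteGaloisGroup K)
        (Subgroup.mem_inf.mp g.2).2 b = 0 ↔
      ∀ x ∈ decomp v, x • (b : W.geomPrimaryTorsion p) = b := by
  constructor
  · intro h x hx
    have hgb : (g : absoluteGaloisGroup K) • (b : W.geomPrimaryTorsion p) = b := by
      have h1 := congrArg (fun z : FixedPoints.addSubgroup ↥(κ.kerSubgroup ⊓ decomp v)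
        (W.geomPrimaryTorsion p) ↦ (z : W.geomPrimaryTorsion p)) h
      simp only [coe_decompSubOne_apply, ZeroMemClass.coe_zero, sub_eq_zero] at h1
      exact h1
    let U : Subgroup ↥((⊤ : Subgroup (absoluteGaloisGroup K)) ⊓ decomp v) :=
      (MulAction.stabilizer (absoluteGaloisGroup K) (b : W.geomPrimaryTorsion p)).subgroupOf _
    have hU : IsOpen (U : Set ↥((⊤ : Subgroup (absoluteGaloisGroup K)) ⊓ decomp v)) :=
      (LocBridge.isOpen_stabilizer_geomPrimaryTorsion W p (b : W.geomPrimaryTorsion p)).preimage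
        continuous_subtype_val
    have hNU : κ.kerSubgroup.subgroupOf ((⊤ : Subgroup (absoluteGaloisGroup K)) ⊓ decomp v) ≤ U := by
      intro x hx
      rw [Subgroup.mem_subgroupOf, MulAction.mem_stabilizer_iff]
      exact b.2 ⟨(x : absoluteGaloisGroup K), Subgroup.mem_inf.mpr
        ⟨Subgroup.mem_subgroupOf.mp hx, (Subgroup.mem_inf.mp x.2).2⟩⟩
    have hgU : g ∈ U := by
      rw [Subgroup.mem_subgroupOf, MulAction.mem_stabilizer_iff]
      exact hgb
    have htop := hgen U hU hNU hgU
    have hxU : (⟨x, Subgroup.mem_inf.mpr ⟨Subgroup.mem_top x, hx⟩⟩ :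
        ↥((⊤ : Subgroup (absoluteGaloisGroup K)) ⊓ decomp v)) ∈ U := by
      rw [htop]; exact Subgroup.mem_top _
    rw [Subgroup.mem_subgroupOf, MulAction.mem_stabilizer_iff] at hxU
    exact hxU
  · intro h
    apply Subtype.ext
    rw [coe_decompSubOne_apply, ZeroMemClass.coe_zero, sub_eq_zero]
    exact h _ (Subgroup.mem_inf.mp g.2).2

end Kernel

/-! ## 2. `B_v → E(K̄)^{I_v}` and the non-singular `p`-primary part `B₀` -/

section Nonsingular

variable {w : Valuation (AlgebraicClosure (v.adicCompletion K)) ℝ≥0}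
  {W₀ : WeierstrassCurve w.integer}
  (hW₀ : ((W.localMinimalIntegralModel v).map (algebraMap (v.adicCompletionIntegers K)
      (v.adicCompletion K))).baseChange (AlgebraicClosure (v.adicCompletion K)) =
    W₀.baseChange (AlgebraicClosure (v.adicCompletion K)))
  (Φ : localPoints W (v.adicCompletion K) ≃+
    (((W.localMinimalIntegralModel v).map (algebraMap (v.adicCompletionIntegers K)
      (v.adicCompletion K))).baseChange (AlgebraicClosure (v.adicCompletion K))).toAffine.Point)

/-- `I_v ≤ ker κ ⊓ D_v` at `v ∤ p` (unramified: `inertia_le_kerSubgroup_holds`; `I_v ≤ D_v`).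
[cite: Washington1997, Prop. 13.2] -/
theorem inertia_le_kerSubgroup_inf_decomp (hpv : (p : 𝓞 K) ∉ v.asIdeal) :
    (adicCompletionPrime K v).inertia (absoluteGaloisGroup K) ≤ κ.kerSubgroup ⊓ decomp v :=
  le_inf (ZpExtension.inertia_le_kerSubgroup_holds K p κ hpv (adicCompletionPrime_mem_primesAbove K v))
    (inertia_adicCompletionPrime_le_decomp v)

/-- **`B_v = E[p^∞]^{ker κ ⊓ D_v} → E(K̄)^{I_v}`**, the inclusion (a `p`-power torsion point fixed by
`ker κ ⊓ D_v ⊇ I_v` is an `I_v`-fixed point). A definition (plumbing).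
[cite: GreenbergLNM1716, §3 Lemma 3.3 (p. 87)] -/
def toInertiaFixed (hpv : (p : 𝓞 K) ∉ v.asIdeal) :
    FixedPoints.addSubgroup ↥(κ.kerSubgroup ⊓ decomp v) (W.geomPrimaryTorsion p) →+
      FixedPoints.addSubgroup ↥((adicCompletionPrime K v).inertia (absoluteGaloisGroup K))
        W.geomPoints where
  toFun b := ⟨((b : W.geomPrimaryTorsion p) : W.geomPoints), fun i ↦ by
    have h := congrArg (fun z : W.geomPrimaryTorsion p ↦ (z : W.geomPoints))
      (b.2 ⟨(i : absoluteGaloisGroup K), inertia_le_kerSubgroup_inf_decomp κ hpv i.2⟩)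
    simpa only [Subgroup.smul_def, primaryComponent.coe_smul] using h⟩
  map_zero' := Subtype.ext rfl
  map_add' _ _ := Subtype.ext rfl

/-- Unfolding `toInertiaFixed` on underlying points. [folklore] -/
@[simp] theorem coe_toInertiaFixed_apply (hpv : (p : 𝓞 K) ∉ v.asIdeal)
    (b : FixedPoints.addSubgroup ↥(κ.kerSubgroup ⊓ decomp v) (W.geomPrimaryTorsion p)) :
    ((toInertiaFixed W κ hpv b : FixedPoints.addSubgroup
        ↥((adicCompletionPrime K v).inertia (absoluteGaloisGroup K)) W.geomPoints) : W.geomPoints) =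
      ((b : W.geomPrimaryTorsion p) : W.geomPoints) := rfl

/-- `toInertiaFixed` is injective. [folklore] -/
theorem toInertiaFixed_injective (hpv : (p : 𝓞 K) ∉ v.asIdeal) :
    Injective (toInertiaFixed W κ hpv) := fun a b h ↦ by
  have h1 := congrArg (fun z : FixedPoints.addSubgroup
    ↥((adicCompletionPrime K v).inertia (absoluteGaloisGroup K)) W.geomPoints ↦ (z : W.geomPoints)) h
  simp only [coe_toInertiaFixed_apply] at h1
  exact Subtype.ext (Subtype.ext h1)

/-- **`B₀ ≤ B_v`: the `p`-power torsion points of `E(K_{∞,η})^{alg}` with NON-SINGULAR reduction**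
on the minimal model at `v` (preimage of route p2's `nonsingularPart = E₀(K_v^{nr})^{alg}`) —
`E₀(K_{∞,η})[p^∞]`, the part of `B_v` coming from `Ẽ_ns(k)[p^∞]` (the `μ_{p^∞}`/torus part at a
multiplicative place). A definition (plumbing). [cite: GreenbergLNM1716, §3 Lemma 3.3 (p. 87) and §4 p. 74]
[cite: SilvermanAEC2009, VII.§2 (`E₀`)] -/
def nonsingularPrimary (hpv : (p : 𝓞 K) ∉ v.asIdeal) :
    AddSubgroup (FixedPoints.addSubgroup ↥(κ.kerSubgroup ⊓ decomp v) (W.geomPrimaryTorsion p)) :=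
  (nonsingularPart W hW₀ Φ).comap (toInertiaFixed W κ hpv)

variable {W κ Φ}

/-- Membership in `B₀`. [folklore] -/
theorem mem_nonsingularPrimary_iff (hpv : (p : 𝓞 K) ∉ v.asIdeal)
    (b : FixedPoints.addSubgroup ↥(κ.kerSubgroup ⊓ decomp v) (W.geomPrimaryTorsion p)) :
    b ∈ nonsingularPrimary W κ hW₀ Φ hpv ↔ toInertiaFixed W κ hpv b ∈ nonsingularPart W hW₀ Φ :=
  AddSubgroup.mem_comap

variable (hw : ∀ x, (w x : ℝ) =
    spectralNorm (v.adicCompletion K) (AlgebraicClosure (v.adicCompletion K)) x)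
  (hΦ : ∀ (σ : absoluteGaloisGroup (v.adicCompletion K)) (Q : localPoints W (v.adicCompletion K)),
    Φ (σ • Q) = Affine.Point.map ((absoluteGaloisGroup.toAlgEquiv _ σ :
        AlgebraicClosure (v.adicCompletion K) ≃ₐ[v.adicCompletion K]
          AlgebraicClosure (v.adicCompletion K)) :
        AlgebraicClosure (v.adicCompletion K) →ₐ[v.adicCompletion K]
          AlgebraicClosure (v.adicCompletion K)) (Φ Q))

include hw hΦ in
/-- **`B₀` is stable under `g − 1` for `g ∈ D_v`** (route p2's (g1): `E₀(K_v^{nr})^{alg}` is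
`D_v`-stable). [cite: SilvermanAEC2009, VII.§2 and VIII.§1] [cite: GreenbergLNM1716, §3 Lemma 3.3 (p. 87)] -/
theorem decompSubOne_mem_nonsingularPrimary [W.IsElliptic] (hpv : (p : 𝓞 K) ∉ v.asIdeal)
    {g : absoluteGaloisGroup K} (hg : g ∈ decomp v)
    {b : FixedPoints.addSubgroup ↥(κ.kerSubgroup ⊓ decomp v) (W.geomPrimaryTorsion p)}
    (hb : b ∈ nonsingularPrimary W κ hW₀ Φ hpv) :
    decompSubOne κ (W.geomPrimaryTorsion p) g hg b ∈ nonsingularPrimary W κ hW₀ Φ hpv := by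
  rw [mem_nonsingularPrimary_iff] at hb ⊢
  have h1 := smul_mem_nonsingularPart hw hW₀ hΦ hg hb
  have e : toInertiaFixed W κ hpv (decompSubOne κ (W.geomPrimaryTorsion p) g hg b) =
      (⟨g • ((toInertiaFixed W κ hpv b : FixedPoints.addSubgroup
          ↥((adicCompletionPrime K v).inertia (absoluteGaloisGroup K)) W.geomPoints) : W.geomPoints),
        smul_mem_fixedPoints_inertia W.geomPoints hg (toInertiaFixed W κ hpv b).2⟩ :
        FixedPoints.addSubgroup ↥((adicCompletionPrime K v).inertia (absoluteGaloisGroup K))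
          W.geomPoints) - toInertiaFixed W κ hpv b := by
    apply Subtype.ext
    change (((g • (b : W.geomPrimaryTorsion p) - b : W.geomPrimaryTorsion p)) : W.geomPoints) =
      g • ((b : W.geomPrimaryTorsion p) : W.geomPoints) - ((b : W.geomPrimaryTorsion p) : W.geomPoints)
    rw [AddSubgroupClass.coe_sub, primaryComponent.coe_smul]
  rw [e]
  exact sub_mem h1 hb

include hw hΦ in
/-- **`B_v/B₀` is finite**: it embeds in `E(K̄)^{I_v}/E₀(K_v^{nr})^{alg}`, finite by Kodaira–Néron over
`K_v^{nr}` (route p2's `finiteIndex_nonsingularPart`). [cite: SilvermanAEC2009, Thm. VII.6.1 / Cor. VII.6.2] -/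
theorem finite_quotient_nonsingularPrimary [W.IsElliptic] (hpv : (p : 𝓞 K) ∉ v.asIdeal) :
    Finite (FixedPoints.addSubgroup ↥(κ.kerSubgroup ⊓ decomp v) (W.geomPrimaryTorsion p) ⧸
      nonsingularPrimary W κ hW₀ Φ hpv) := by
  haveI := finiteIndex_nonsingularPart hw hW₀ hΦ
  haveI : Finite (FixedPoints.addSubgroup ↥((adicCompletionPrime K v).inertia (absoluteGaloisGroup K))
      W.geomPoints ⧸ nonsingularPart W hW₀ Φ) := AddSubgroup.finite_quotient_of_finiteIndex
  let f := QuotientAddGroup.map (nonsingularPrimary W κ hW₀ Φ hpv) (nonsingularPart W hW₀ Φ)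
    (toInertiaFixed W κ hpv) le_rfl
  refine Finite.of_injective f fun x y hxy ↦ ?_
  induction x using QuotientAddGroup.induction_on with
  | H a =>
    induction y using QuotientAddGroup.induction_on with
    | H b =>
      rw [QuotientAddGroup.map_mk, QuotientAddGroup.map_mk, QuotientAddGroup.eq_iff_sub_mem,
        ← map_sub] at hxy
      rw [QuotientAddGroup.eq_iff_sub_mem]
      exact hxy

end Nonsingular

end Summit.BirchSwinnertonDyer.Rank1Residual.X11b.AcSelmer

end
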